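import Mathlib

/-!
# THE LAYER-CAKE LEMMA FOR BINOMIAL WEIGHTS (night-3 g27)

`proofs/NIGHT3-G27-PLD.md` §3.  A binomial coefficient `C(M, z)` is a nonnegative combination of indicators of the
symmetric intervals `j ≤ z ≤ M − j`, `j ≤ M/2`:
  `C(M, z) = Σ_{j ≤ M/2} [j ≤ z ∧ z + j ≤ M] · d_j`,  `d_0 = 1`, `d_j = C(M, j) − C(M, j−1)` (`choose_eq_sum_intervals`),
because `C(M, ·)` is symmetric and non-decreasing up to `M/2` (`Nat.choose_le_succ_of_lt_half_left`).  Hence an inequality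
`Σ_x C(M, q−x)·g(x) ≤ Σ_x C(M, q−x)·h(x)` follows from the INTERVAL inequalities
`Σ_{x : j ≤ q−x ≤ M−j} g(x) ≤ Σ_{x : j ≤ q−x ≤ M−j} h(x)` for every `j ≤ M/2` (`sum_choose_mul_le_of_intervals`).
This is how the per-layer dominance (PLD) of a fat matroid gives every row `(q, u)` of `M ⊕ U_{m,m}`: in layer `δ` the
free-part weight of a fat type `x` is `C(m, e−δ)·C(m−e+δ, q−x)`.  No `def`, no `instance`, no notation.  Axioms: standard.
-/

namespace PercRepro

namespace LayerCake

open Finset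

/-- The increments of `C(M, ·)` sum to `C(M, n)` below the middle: for `n ≤ M/2`,
`Σ_{j ≤ n} d_j = C(M, n)` with `d_0 = 1`, `d_j = C(M, j) − C(M, j−1)`. -/
theorem sum_increments_eq_choose (M : ℕ) : ∀ n, n ≤ M / 2 →
    (∑ j ∈ range (n + 1), (if j = 0 then 1 else M.choose j - M.choose (j - 1))) = M.choose n := by
  intro n
  induction n with
  | zero => intro _; simp
  | succ n ih =>
    intro hn
    rw [sum_range_succ, ih (by omega)]
    have hmono : M.choose n ≤ M.choose (n + 1) := Nat.choose_le_succ_of_lt_half_left (by omega)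
    rw [if_neg (by omega), show n + 1 - 1 = n by omega]
    omega

/-- **Binomial coefficients as combinations of symmetric intervals**: for every `M z`,
`C(M, z) = Σ_{j ∈ range (M/2 + 1)} [j ≤ z ∧ z + j ≤ M] · d_j`. -/
theorem choose_eq_sum_intervals (M z : ℕ) :
    M.choose z = ∑ j ∈ range (M / 2 + 1),
      (if j ≤ z ∧ z + j ≤ M then (if j = 0 then 1 else M.choose j - M.choose (j - 1)) else 0) := by
  by_cases hz : z ≤ M
  · -- the interval condition is `j ≤ min z (M − z)`, and `min z (M−z) ≤ M/2`
    have hmin : min z (M - z) ≤ M / 2 := by omega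
    have hfilt : (∑ j ∈ range (M / 2 + 1),
        (if j ≤ z ∧ z + j ≤ M then (if j = 0 then 1 else M.choose j - M.choose (j - 1)) else 0)) =
        ∑ j ∈ range (min z (M - z) + 1), (if j = 0 then 1 else M.choose j - M.choose (j - 1)) := by
      rw [← sum_filter]
      apply sum_congr
      · ext j
        simp only [mem_filter, mem_range]
        omega
      · intro j _; rfl
    rw [hfilt, sum_increments_eq_choose M _ hmin]
    rcases le_total z (M - z) with h | h
    · rw [min_eq_left h]
    · rw [min_eq_right h, Nat.choose_symm hz]
  · -- `z > M`: both sides vanish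
    rw [Nat.choose_eq_zero_of_lt (by omega)]
    symm
    apply sum_eq_zero
    intro j _
    rw [if_neg]
    omega

/-- **THE LAYER-CAKE LEMMA**: if for every `j ≤ M/2` the interval sums satisfy
`Σ_{x ≤ q : j ≤ q−x ≤ M−j} g x ≤ Σ_{x ≤ q : j ≤ q−x ≤ M−j} h x`, then
`Σ_{x ≤ q} C(M, q−x)·g x ≤ Σ_{x ≤ q} C(M, q−x)·h x`. -/
theorem sum_choose_mul_le_of_intervals (M q : ℕ) (g h : ℕ → ℕ)
    (hint : ∀ j, j ≤ M / 2 →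
      (∑ x ∈ (range (q + 1)).filter (fun x => j ≤ q - x ∧ q - x + j ≤ M), g x) ≤
        ∑ x ∈ (range (q + 1)).filter (fun x => j ≤ q - x ∧ q - x + j ≤ M), h x) :
    (∑ x ∈ range (q + 1), M.choose (q - x) * g x) ≤ ∑ x ∈ range (q + 1), M.choose (q - x) * h x := by
  -- expand the weight and swap the sums
  have expand : ∀ (g : ℕ → ℕ), (∑ x ∈ range (q + 1), M.choose (q - x) * g x) =
      ∑ j ∈ range (M / 2 + 1), (if j = 0 then 1 else M.choose j - M.choose (j - 1)) *
        ∑ x ∈ (range (q + 1)).filter (fun x => j ≤ q - x ∧ q - x + j ≤ M), g x := by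
    intro g
    calc (∑ x ∈ range (q + 1), M.choose (q - x) * g x)
        = ∑ x ∈ range (q + 1), ∑ j ∈ range (M / 2 + 1),
            (if j ≤ q - x ∧ q - x + j ≤ M then (if j = 0 then 1 else M.choose j - M.choose (j - 1)) else 0) * g x := by
          apply sum_congr rfl
          intro x _
          rw [choose_eq_sum_intervals M (q - x), sum_mul]
      _ = ∑ j ∈ range (M / 2 + 1), ∑ x ∈ range (q + 1),
            (if j ≤ q - x ∧ q - x + j ≤ M then (if j = 0 then 1 else M.choose j - M.choose (j - 1)) * g x else 0) := by
          rw [sum_comm]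
          apply sum_congr rfl
          intro j _
          apply sum_congr rfl
          intro x _
          split_ifs <;> simp
      _ = ∑ j ∈ range (M / 2 + 1), (if j = 0 then 1 else M.choose j - M.choose (j - 1)) *
            ∑ x ∈ (range (q + 1)).filter (fun x => j ≤ q - x ∧ q - x + j ≤ M), g x := by
          apply sum_congr rfl
          intro j _
          rw [← sum_filter, mul_sum]
  rw [expand g, expand h]
  apply sum_le_sum
  intro j hj
  rw [mem_range] at hj
  exact Nat.mul_le_mul_left _ (hint j (by omega))

end LayerCake

end PercRepro
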